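import Literature.Computability.Complexity.MurrayWilliams2018Hierarchy
import Literature.Computability.Complexity.NTIMEPadding
import Literature.Computability.Complexity.Williams2014AccSatAssembly
import HarnessLib

/-!
# Murray–Williams 2018, Theorem 1.2 for `AC⁰[m]`: the simulation may be run at the EXPONENTIAL level

Fifth layer under the named facts `MurrayWilliams2018_NTIME_not_depth_ACC` (C. D. Murray,
R. R. Williams, *Circuit lower bounds for nondeterministic quasi-polytime: an easy witness lemma
for NP and NQP*, STOC 2018, Thm. 1.3, threshold-free), `MurrayWilliams2018_NQP_not_ACC` and
`MurrayWilliams2018_NQP_not_subset_ACC0` (`CircuitLowerBounds.lean`).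
`MurrayWilliams2018Hierarchy.lean` proves the assembly of the source's Theorem 1.2 for `AC⁰[m]`
over the tree's PROVED nondeterministic time hierarchy theorem from two hypotheses: `hEWL` (the
easy witness lemma for `NQP`, Lemma 1.3, itself derived from `MurrayWilliams2018_lemma_4_1_ae`)
and `hN`, the nondeterministic simulation `N` of §5 for a hard language at the quasi-polynomial
level `g = smoothQP E`. A discharge of that `hN` needs, besides the machine `N`, a succinct
`SAT`-presentation of `NTIME[g]`-computations with `log₂ g + O(log log g)` variables — the PCP
of Ben-Sasson–Viola [BSV14] in print, or an efficient succinct Cook–Levin theorem at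
quasi-polynomial time bounds — and the tree has neither. What the tree HAS is the exponential
level of Williams' proof of `NEXP ⊄ ACC⁰`: the efficient succinct Cook–Levin reduction for
`NTIME[2ⁿ]` as the named fact `Williams2014_fact_3_1` (`Williams2014Transfer.lean`, reduced to
`Williams2014_fact_3_1_skeleton` in `SuccinctSkeletonReductions.lean`), the clause-table
verifier of level `2^{n³}` whose witnesses are the satisfying assignments
(`exists_clauseTableVerifier`, `SuccinctWitnessesFromUWC.lean`), the machine `B` of Williams'
Thm. 3.2 as a THEOREM (`Williams2014_thm_3_2_machineB_holds`, `Williams2014SatInstanceFP.lean`)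
and the hard language `NTIME[2ⁿ] ∖ NTIME[n + 2ⁿ/n]` of the proved hierarchy theorem.

This file therefore moves the simulation hypothesis to the exponential level and PROVES that
Theorem 1.2 for `AC⁰[m]` still follows. The point is a padding argument in the direction that
works: assumption (A) of the proof of Theorem 1.2 and the easy witness lemma speak about `NQP`,
and a language `L₁ ∈ NTIME[2ⁿ]` is brought INTO `NQP` by a subexponential pad — the word
`⟨x, 1^{2^M}⟩`, `M = ⌊N^{1/q'}⌋ + 1`, `N = |x|`, has length `n` with `(log₂ n)^{q'} ≳ N`, so a
`2^{N³}`-time verification of `x` costs `n^{(log₂ n)^{O(q')}}` — while the witness circuits of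
size `2^{(log₂ n)^K}` that Lemma 1.3 provides for the padded language come back to the
`2^{N³}`-verifiers of `L₁` with size `2^{(M + 1)^K} ≤ 2^{⌊N^{1/q}⌋}` once `q' = 2Kq`: SUBEXPONENTIAL
witness circuits, exactly the regime of the `AC⁰[m]`-SAT algorithm with savings `2^{⌊n^{1/r}⌋}`
(`AccSatSubexp`). (The converse transfer, from the exponential level down to `NQP`, is not
available — inputs cannot be compressed — which is why the hard language, not assumption (A), is
the object that changes level.)

* `lenNumFn`, `sizeNumFn`, `validQFn`, **`unpadQ q`** (all in `FP`, from the tree's bricks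
  `popCountFn`, `onesFn`, `natPowFn`, `addFn`, `ltFn`, `iteFn`): the total unpadding — a word
  `z = ⟨x, u⟩` with `|x| ≤ (Nat.size |z|)^q` is sent to `x`, every other word to `ε`;
  `padQ q x = ⟨x, 1^{2^{M(|x|)}}⟩`, `padLenQ`, `padExpQ q N = ⌊N^{1/q}⌋ + 1`, and the padded
  language **`padLangQ q L = (unpadQ q)⁻¹' L`** (`unpadQ_padQ`, `padQ_mem_padLangQ`);
* `two_pow_pow_le_level` — on valid pads the source level fits under the target level:
  `N₀ ≤ (Nat.size n)^q ⟹ 2^{N₀ʲ} ≤ A · n^{(log₂ n)^e} + A` for `2jq ≤ e + 1`;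
* **`exists_padVerifierQ`** — a correct `2^{nʲ}`-time verifier `V` of `L` yields a correct
  verifier of `padLangQ q L` at the level `n^{(log₂ n)^e}` (`2jq ≤ e + 1`, `e ≥ 1`) with relation
  `V.rel (unpadQ q z) (y ↾ (c · 2^{|unpadQ q z|ʲ} + c))` — the truncating wrapper `truncMapAux`
  for the clock `z ↦ expClock c j (unpadQ q z)` followed by `V.machine`, the construction of
  `padPre_mem_NTIME_two_pow` (`NTIMEPadding.lean`) with the subexponential unpadding; hence
  **`padLangQ_mem_NTIME_level`** and **`HasWitnessCircuits.of_padLangQ`** (witness circuits of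
  the padded language at the level `n^{(log₂ n)^e}` come back to the `2^{nʲ}`-verifiers of `L`
  with size `w (padLenQ q N)`);
* `eventually_log_padLenQ_pow_le` — with `q' = 2Kq`, eventually
  `(log₂ (padLenQ q' N))^K ≤ ⌊N^{1/q}⌋`;
* `exists_mem_NTIME_two_pow_not_mem_williamsBound` — the hard language
  `L₁ ∈ NTIME[2ⁿ] ∖ NTIME[n + 2ⁿ/n]` from `Diag.ntime_hierarchy_holds`;
* **`MurrayWilliams2018_thm_1_2_acc_of_EWL_of_expSimulation`** — Theorem 1.2 for `AC⁰[m]`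
  from `hEWL` and the exponential-level simulation hypothesis `hN` below;
* **`MurrayWilliams2018_thm_1_2_acc_of_lemma_4_1_ae_of_expSimulation`**,
  **`MurrayWilliams2018_NQP_not_ACC_of_lemma_4_1_ae_of_expSimulation`**,
  **`MurrayWilliams2018_NQP_not_subset_ACC0_of_lemma_4_1_ae_of_expSimulation`**,
  **`MurrayWilliams2018_NTIME_not_depth_ACC_of_lemma_4_1_ae_of_expSimulation`** — the three
  Murray–Williams facts of `CircuitLowerBounds.lean` over the remaining unproved components:
  `MurrayWilliams2018_lemma_4_1_ae` (named fact), the exponential-level simulation (inline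
  hypothesis) and Williams' `ACC`-SAT algorithm `Williams2014_thm_4_1` (named fact).

No notion beyond the padding functions and no named fact is introduced (definitions with bodies
and theorems only).

## The exponential-level simulation hypothesis

`hN : ∃ c₀, ∀ d m k r, 2 ≤ m → 1 ≤ k → 2 ≤ r → AccSatSubexp (d + c₀) m r →
  (P ⊆ ⋃ₐ DepthSizeClass (accBasis m) d (a · 2^{(log₂ n)^k} + a)) →
  ∃ q ≥ 1, ∀ L ∈ NTIME (2 ^ ·), HasWitnessCircuits (2^{n³}) L (2^{⌊n^{1/q}⌋}) → L ∈ NTIME williamsBound`.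

In words: given the depth-`(d + c₀)` `AC⁰[m]`-SAT algorithm on `n`-input circuits of size
`2^{⌊n^{1/r}⌋}` in time `2^{n - ⌊n^{1/r}⌋}` (Murray–Williams' hypothesis (B) for `C = AC⁰[m]`, in
the deterministic exact form of Williams' Thm. 4.1 / the source's Thm. 5.1) and depth-`d`
`AC⁰[m]` circuits of size `2^{(log₂ n)^k}` for all of `P` (the consequence of hypothesis (A) used
in §5: "By assumption (A), EVAL-GATE has `C`-circuits"), the simulation announces a witness-size
exponent `q` and puts every `L ∈ NTIME[2ⁿ]` whose `2^{n³}`-verifiers have witness circuits of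
size `2^{⌊n^{1/q}⌋}` into `NTIME[n + 2ⁿ/n]`. This is the machine `N` of §5 (p. 14) run on an
`NTIME[2ⁿ]` language: step 1 produces the succinct `3SAT` instance of `x` (Williams 2014,
Fact 3.1, `poly(n)` time, `n + c log n` variables — in place of the circuit `C_x^O` of [BSV14]);
step 2 guesses a witness circuit `W` of size `2^{⌊n^{1/q}⌋}` encoding a satisfying assignment
(it exists for the long `x ∈ L` by the hypothesis applied to the clause-table verifier
`exists_clauseTableVerifier`, of level `2^{n³}`); steps 3–4 are replaced, as printed, by guessing
a depth-`d` `AC⁰[m]` circuit `E` for EVAL-GATE on the composed circuit, building the consistency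
circuit `D` (depth `d + O(1)`, `n + c log n + c` inputs, size `2^{O(n^{k/q})} ≤ 2^{⌊n^{1/r}⌋}`
for `q > kr`) and calling the SAT algorithm on `D` and on `E(·, s)`, in time
`2^{n + c log n + c - ⌊n^{1/r}⌋} · 2^{O(n^{1/q})} = O(2ⁿ/n)`. Its discharge is thus a machine
construction over `Williams2014_fact_3_1` in the toolkit that proved
`Williams2014_thm_3_2_machineB_holds`; it is NOT attempted in this file.

## Faithfulness notes

* The printed proof of Theorem 1.2 takes the hard language at the level
  `t(n) = 2^{log^{ck⁴/ε} n}` ("Take `L ∈ NTIME[t(n)] − NTIME[t(n)/2^{log^{ε/2} t(n)}]`", p. 15) and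
  simulates there; the proof of Theorem 1.1 does the same at `t(n) = n^{ck⁴/ε}`, and the source
  presents both as instances of one method ("The proof is similar to earlier arguments
  [Wil10, Wil11, SW13]", p. 14; "We use the exact same strategy as Theorem 1.1", p. 15). Running
  the method at `t(n) = 2ⁿ` for a subexponentially PADDED hard language is a third instance: the
  contradiction `NTIME[2ⁿ] ⊆ NTIME[n + 2ⁿ/n]` is Williams' (J. ACM 2014, proof of Thm. 1.1),
  the witness circuits come from Murray–Williams' Lemma 1.3 through the pad, and the named facts
  proved from the assembly are unchanged. The quasi-polynomial-level assemblies of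
  `MurrayWilliams2018Hierarchy.lean` / `MurrayWilliams2018LevelSimulation.lean` remain valid
  alternatives; a discharge of either simulation hypothesis closes the three facts given
  `MurrayWilliams2018_lemma_4_1_ae` and `Williams2014_thm_4_1`.
* `hEWL` is used at ALL large levels `e` (Lemma 1.3 is stated for every `L ∈ NQP`): the padded
  language sits in the level `e = max e₀ (12Kq)`, chosen after the simulation has named `q`.
* Invalid words are unpadded to `ε` (the convention of `polyUnpad`, `NTIMEPadding.lean`), so
  `padLangQ q L` contains every invalid word iff `ε ∈ L`; only the canonical pads `padQ q x` are
  used to transport witnesses.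

## Trust base

After this file: `MurrayWilliams2018_NTIME_not_depth_ACC` (and the two `NQP` facts) follow from
`{MurrayWilliams2018_lemma_4_1_ae, the exponential-level simulation (inline; dischargeable over
Williams2014_fact_3_1 by a machine construction), Williams2014_thm_4_1}`.

## References

* C. D. Murray, R. R. Williams, *Circuit lower bounds for nondeterministic quasi-polytime: an
  easy witness lemma for NP and NQP*, STOC 2018, 890–901, §2 (witness circuits), Lemma 1.3,
  Thm. 1.2 and its proof (§5, pp. 14–15), Remark 1, Thm. 1.3, Thm. 5.1 [MurrayWilliams2018].
* R. Williams, *Nonuniform ACC circuit lower bounds*, J. ACM 61 (2014) 2:1–2:32, Fact 3.1,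
  Thm. 3.2, Thm. 4.1, proof of Thm. 1.1 (pp. 17–18) [Williams2014].
* E. Ben-Sasson, E. Viola, *Short PCPs with projection queries*, ICALP 2014 [BSV14] (the
  ingredient replaced at the exponential level).
* S. Arora, B. Barak, *Computational Complexity: A Modern Approach*, CUP 2009, §2.6.2 and
  Thm. 2.22 (padding), Def. 2.1 / §2.1.2 and Thm. 2.6 (verifiers), §1.3 (time-constructible
  functions), Thm. 3.2 (nondeterministic time hierarchy) [AroraBarak2009].
-/

namespace Literature.Computability.Complexity

open _root_.Computability Turing Filter Asymptotics Polynomial Brick HashBricks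

/-! ### Numerals of lengths, the validity test, the unpadding -/

/-- `w ↦ bin |w|`: the length of a word as a binary numeral (population count of `1^{|w|}`).
[folklore] -/
noncomputable def lenNumFn : List Bool → List Bool := popCountFn ∘ onesFn

/-- Value of `lenNumFn`. [folklore] -/
@[simp] theorem lenNumFn_apply (w : List Bool) : lenNumFn w = encodeNat w.length := by
  simp only [lenNumFn, Function.comp_apply, popCountFn_apply, onesFn,
    OracleCompose.unaryEncodeNat_eq_replicate, List.count_replicate_self]

/-- `lenNumFn ∈ FP`. [folklore] -/
theorem lenNumFn_mem_FP : lenNumFn ∈ FP := comp_mem_FP popCountFn_mem_FP onesFn_mem_FP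

/-- `w ↦ bin (Nat.size |w|)` (`Nat.size |w| = |bin |w||`). [folklore] -/
noncomputable def sizeNumFn : List Bool → List Bool := lenNumFn ∘ lenNumFn

/-- Value of `sizeNumFn`. [folklore] -/
@[simp] theorem sizeNumFn_apply (w : List Bool) : sizeNumFn w = encodeNat (Nat.size w.length) := by
  simp only [sizeNumFn, Function.comp_apply, lenNumFn_apply, TM2Pass.length_encodeNat_eq_size]

/-- `sizeNumFn ∈ FP`. [folklore] -/
theorem sizeNumFn_mem_FP : sizeNumFn ∈ FP := comp_mem_FP lenNumFn_mem_FP lenNumFn_mem_FP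

/-- The validity test of the subexponential padding with parameter `q`:
`z ↦ [ |fst z| < (Nat.size |z|)^q + 1 ]` — the payload is polylogarithmically short.
[folklore] -/
noncomputable def validQFn (q : ℕ) : List Bool → List Bool :=
  ltFn ∘ fanoutFn (lenNumFn ∘ fstF)
    (addFn ∘ fanoutFn (natPowFn q ∘ sizeNumFn) (fun _ => encodeNat 1))

/-- Value of the validity test. [folklore] -/
theorem validQFn_apply (q : ℕ) (z : List Bool) :
    validQFn q z = [decide ((fstF z).length ≤ Nat.size z.length ^ q)] := by
  simp only [validQFn, Function.comp_apply, fanoutFn_apply, lenNumFn_apply, sizeNumFn_apply,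
    natPowFn_apply, bitsToNat_encodeNat, addFn_boolPair, ltFn_boolPair, Nat.lt_succ_iff]

/-- `validQFn q ∈ FP`. [folklore] -/
theorem validQFn_mem_FP (q : ℕ) : validQFn q ∈ FP :=
  comp_mem_FP ltFn_mem_FP
    (fanoutFn_mem_FP (comp_mem_FP lenNumFn_mem_FP fstF_mem_FP)
      (comp_mem_FP addFn_mem_FP
        (fanoutFn_mem_FP (comp_mem_FP (natPowFn_mem_FP q) sizeNumFn_mem_FP) (const_mem_FP _))))

/-- **The total unpadding** `unpadQ q`: a word `z = ⟨x, u⟩` whose payload `x` has length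
`≤ (Nat.size |z|)^q` is sent to `x`, every other word to `ε`. [folklore] -/
noncomputable def unpadQ (q : ℕ) : List Bool → List Bool :=
  iteFn (validQFn q) fstF fun _ => []

/-- `unpadQ q ∈ FP`. [folklore] -/
theorem unpadQ_mem_FP (q : ℕ) : unpadQ q ∈ FP :=
  iteFn_mem_FP (validQFn_mem_FP q) fstF_mem_FP (const_mem_FP [])

/-- The unpadding as an honest `if`. [folklore] -/
theorem unpadQ_eq (q : ℕ) (z : List Bool) :
    unpadQ q z = if (fstF z).length ≤ Nat.size z.length ^ q then fstF z else [] := by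
  by_cases h : (fstF z).length ≤ Nat.size z.length ^ q
  · have hv : validQFn q z = [true] := by rw [validQFn_apply, decide_eq_true h]
    rw [unpadQ, iteFn_apply_true hv, if_pos h]
  · have hv : validQFn q z = [false] := by rw [validQFn_apply, decide_eq_false h]
    rw [unpadQ, iteFn_apply_false hv, if_neg h]

/-- The unpadding is polylogarithmically short: `|unpadQ q z| ≤ (Nat.size |z|)^q`. [folklore] -/
theorem length_unpadQ_le_size_pow (q : ℕ) (z : List Bool) :
    (unpadQ q z).length ≤ Nat.size z.length ^ q := by
  rw [unpadQ_eq]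
  split_ifs with h
  · exact h
  · exact Nat.zero_le _

/-- The unpadding is not longer than the word. [folklore] -/
theorem length_unpadQ_le (q : ℕ) (z : List Bool) : (unpadQ q z).length ≤ z.length := by
  rw [unpadQ_eq]
  split_ifs with h
  · have := length_fstF_sndF_le z; omega
  · exact Nat.zero_le _

/-! ### The canonical pad and the padded language -/

/-- The pad exponent `M(N) = ⌊N^{1/q}⌋ + 1`. [folklore] -/
def padExpQ (q N : ℕ) : ℕ := Nat.nthRoot q N + 1

/-- **The canonical subexponential pad** `padQ q x = ⟨x, 1^{2^{M(|x|)}}⟩`, `M(N) = ⌊N^{1/q}⌋ + 1`.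
[folklore] -/
def padQ (q : ℕ) (x : List Bool) : List Bool := boolPair x (ones (2 ^ padExpQ q x.length))

/-- The length of the canonical pad of a word of length `N`: `2N + 2 + 2^{M(N)}`. [folklore] -/
def padLenQ (q N : ℕ) : ℕ := 2 * N + 2 + 2 ^ padExpQ q N

/-- Length of the canonical pad. [folklore] -/
@[simp] theorem length_padQ (q : ℕ) (x : List Bool) : (padQ q x).length = padLenQ q x.length := by
  simp [padQ, padLenQ]

/-- The payload of the canonical pad. [folklore] -/
@[simp] theorem fstF_padQ (q : ℕ) (x : List Bool) : fstF (padQ q x) = x := by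
  simp [padQ]

/-- `N ≤ padLenQ q N`. [folklore] -/
theorem le_padLenQ (q N : ℕ) : N ≤ padLenQ q N :=
  (show N ≤ 2 * N + 2 by omega).trans (Nat.le_add_right _ _)

/-- `2 ^ M(N) ≤ padLenQ q N`. [folklore] -/
theorem two_pow_padExpQ_le_padLenQ (q N : ℕ) : 2 ^ padExpQ q N ≤ padLenQ q N := Nat.le_add_left _ _

/-- The canonical pad is valid: `N ≤ (Nat.size (padLenQ q N))^q` (`q ≠ 0`), because
`Nat.size (padLenQ q N) ≥ M(N) + 1` and `(⌊N^{1/q}⌋ + 1)^q > N`. [folklore] -/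
theorem le_size_padLenQ_pow {q : ℕ} (hq : q ≠ 0) (N : ℕ) : N ≤ Nat.size (padLenQ q N) ^ q := by
  have h1 : padExpQ q N < Nat.size (padLenQ q N) := Nat.lt_size.2 (two_pow_padExpQ_le_padLenQ q N)
  have h2 : N < (Nat.nthRoot q N + 1) ^ q := Nat.lt_pow_nthRoot_add_one hq N
  have h3 : (Nat.nthRoot q N + 1) ^ q ≤ Nat.size (padLenQ q N) ^ q :=
    Nat.pow_le_pow_left (by unfold padExpQ at h1; omega) q
  omega

/-- Unpadding the canonical pad recovers the payload (`q ≠ 0`). [folklore] -/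
@[simp] theorem unpadQ_padQ {q : ℕ} (hq : q ≠ 0) (x : List Bool) : unpadQ q (padQ q x) = x := by
  rw [unpadQ_eq, fstF_padQ, length_padQ, if_pos (le_size_padLenQ_pow hq x.length)]

/-- **The padded language** `padLangQ q L = (unpadQ q)⁻¹' L`. [folklore] -/
def padLangQ (q : ℕ) (L : Language Bool) : Language Bool := {z | unpadQ q z ∈ L}

/-- Membership in the padded language (definitional). [folklore] -/
@[simp] theorem mem_padLangQ {q : ℕ} {L : Language Bool} {z : List Bool} :
    z ∈ padLangQ q L ↔ unpadQ q z ∈ L := Iff.rfl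

/-- The canonical pad of `x` is in the padded language iff `x ∈ L` (`q ≠ 0`). [folklore] -/
theorem padQ_mem_padLangQ {q : ℕ} (hq : q ≠ 0) {L : Language Bool} {x : List Bool} :
    padQ q x ∈ padLangQ q L ↔ x ∈ L := by
  rw [mem_padLangQ, unpadQ_padQ hq]


/-! ### Growth of the tree's levels `n ^ (log₂ n)^e` -/

/-- **The source level fits under the target level on valid pads**: if `N₀ ≤ (Nat.size n)^q`
then `2^{N₀^j} ≤ A · n^{(log₂ n)^e} + A`, provided `2jq ≤ e + 1` (for `n ≥ 4`:
`(log₂ n + 1)^{jq} ≤ (log₂ n)^{2jq} ≤ (log₂ n)^{e+1}` and `2^{(log₂ n)^{e+1}} ≤ n^{(log₂ n)^e}`;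
smaller `n` are absorbed by `A = 2^{2^{jq}}`). [folklore] -/
theorem two_pow_pow_le_level {j q e : ℕ} (he : 2 * j * q ≤ e + 1) :
    ∃ A : ℕ, ∀ n N₀ : ℕ, N₀ ≤ Nat.size n ^ q → 2 ^ (N₀ ^ j) ≤ A * n ^ Nat.log 2 n ^ e + A := by
  refine ⟨2 ^ (2 ^ (j * q)), fun n N₀ hN₀ => ?_⟩
  have hNj : N₀ ^ j ≤ Nat.size n ^ (j * q) := by
    calc N₀ ^ j ≤ (Nat.size n ^ q) ^ j := Nat.pow_le_pow_left hN₀ j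
      _ = Nat.size n ^ (j * q) := by rw [← pow_mul, mul_comm]
  rcases lt_or_ge n 4 with hn | hn
  · have hs : Nat.size n ≤ 2 := Nat.size_le.2 (by omega)
    have h : 2 ^ (N₀ ^ j) ≤ 2 ^ (2 ^ (j * q)) :=
      Nat.pow_le_pow_right two_pos (hNj.trans (Nat.pow_le_pow_left hs _))
    exact h.trans (Nat.le_add_left _ _)
  · set l := Nat.log 2 n with hl
    have hl2 : 2 ≤ l := Nat.le_log_of_pow_le one_lt_two hn
    have hs : Nat.size n = l + 1 :=
      le_antisymm (Nat.size_le.2 (Nat.lt_pow_succ_log_self one_lt_two n))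
        (Nat.lt_size.2 (Nat.pow_log_le_self 2 (by omega)))
    have h1 : l + 1 ≤ l * l := by nlinarith
    have h2 : (l + 1) ^ (j * q) ≤ l ^ (e + 1) :=
      calc (l + 1) ^ (j * q) ≤ (l * l) ^ (j * q) := Nat.pow_le_pow_left h1 _
        _ = l ^ (2 * j * q) := by rw [← pow_two, ← pow_mul, mul_assoc]
        _ ≤ l ^ (e + 1) := Nat.pow_le_pow_right (by omega) he
    have h3 : 2 ^ (N₀ ^ j) ≤ n ^ l ^ e :=
      calc 2 ^ (N₀ ^ j) ≤ 2 ^ (l ^ (e + 1)) := Nat.pow_le_pow_right two_pos (hNj.trans (hs ▸ h2))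
        _ = (2 ^ l) ^ (l ^ e) := by rw [pow_succ', pow_mul]
        _ ≤ n ^ (l ^ e) := Nat.pow_le_pow_left (Nat.pow_log_le_self 2 (by omega)) _
    exact h3.trans (le_add_right (Nat.le_mul_of_pos_left _ (by positivity)))

/-- Every polynomial is below every level `n ^ (log₂ n)^e`, `e ≥ 1`, up to constants
(`natPoly_exists_eval_le_pow_log`, `pow_log_pow_exp_mono`). [folklore] -/
theorem exists_poly_le_level (p : Polynomial ℕ) {e : ℕ} (he : 1 ≤ e) :
    ∃ A : ℕ, ∀ n, p.eval n ≤ A * n ^ Nat.log 2 n ^ e + A := by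
  obtain ⟨c, hc⟩ := natPoly_exists_eval_le_pow_log p
  refine ⟨c, fun n => (hc n).trans ?_⟩
  have h := pow_log_pow_exp_mono he n
  rw [pow_one] at h
  exact Nat.add_le_add_right (Nat.mul_le_mul_left c h) c

/-! ### The verifier of the padded language -/

/-- **The clock machine behind the unpadding**: some machine maps every word `z` to
`expClock c j (unpadQ q z) = ⟨unpadQ q z, 1^{c · 2^{|unpadQ q z|^j} + c}⟩` within
`p(|z|) + C · 2^{|unpadQ q z|^j}` steps: the `FP` machine of `unpadQ q` followed by the
exponential clock program of `NTIMEPadding.lean` (`exists_timeComputable_expClock`, `1 ≤ j`).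
[folklore] -/
theorem exists_clockQ_machine (c q : ℕ) {j : ℕ} (hj : 1 ≤ j) :
    ∃ (p : Polynomial ℕ) (C : ℕ) (N : TM2ComputableAux Bool Bool), ∀ z : List Bool,
      N.OutputsWithin z (expClock c j (unpadQ q z))
        (p.eval z.length + C * 2 ^ ((unpadQ q z).length ^ j)) := by
  obtain ⟨p₁, U, hU⟩ := unpadQ_mem_FP q
  obtain ⟨C, Ck, hCk⟩ := exists_timeComputable_expClock c hj
  refine ⟨p₁ + Polynomial.C C, C, U.comp Ck, fun z => ?_⟩
  have h := Turing.TM2ComputableAux.comp_outputsWithin U Ck (hU z) (hCk (unpadQ q z))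
  refine h.mono ?_
  simp only [id, eval_add, eval_C]
  omega

/-- **The padded verifier.** A correct `2^{nʲ}`-time verifier `V` of `L` (`1 ≤ j`) yields a
correct verifier of `padLangQ q L` at the level `n ^ (log₂ n)^e` whenever `2jq ≤ e + 1`,
`e ≥ 1`, with the relation `V.rel (unpadQ q z) (y ↾ (c · 2^{|unpadQ q z|ʲ} + c))`: the machine is
the truncating wrapper `truncMapAux` (`TruncMapMachine.lean`) for the clock
`z ↦ expClock c j (unpadQ q z)` followed by `V.machine` (the construction of
`padPre_mem_NTIME_two_pow`, `NTIMEPadding.lean`); on a valid pad `|unpadQ q z| ≤ (Nat.size |z|)^q`,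
so `2^{|unpadQ q z|ʲ} = O(|z|^{(log₂ |z|)^e})` (`two_pow_pow_le_level`).
[cite: AroraBarak2009, §2.6.2 (Thm. 2.22)] -/
theorem exists_padVerifierQ {j q e : ℕ} (hj : 1 ≤ j) (he : 2 * j * q ≤ e + 1) (he1 : 1 ≤ e)
    {L : Language Bool} (V : NVerifier (fun n => 2 ^ (n ^ j)) L) :
    ∃ V' : NVerifier (fun n => n ^ Nat.log 2 n ^ e) (padLangQ q L),
      ∀ z y : List Bool, V'.rel z y =
        V.rel (unpadQ q z) (y.take (V.c * 2 ^ ((unpadQ q z).length ^ j) + V.c)) := by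
  obtain ⟨p, C, Nc, hNc⟩ := exists_clockQ_machine V.c q hj
  obtain ⟨A, hA⟩ := two_pow_pow_le_level (j := j) (q := q) he
  obtain ⟨A', hA'⟩ := exists_poly_le_level (p + 5 * X + 11) he1
  set c := V.c with hc
  let B : List Bool → ℕ := fun z => c * 2 ^ ((unpadQ q z).length ^ j) + c
  let K : ℕ := A' + (C + 3 * c) * A + 3 * c
  refine ⟨⟨2 * K + 2, fun z y => V.rel (unpadQ q z) (y.take (B z)), (truncMapAux Nc).comp V.machine,
    fun z y hy => ?_, fun z => ?_⟩, fun z y => rfl⟩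
  · -- running time
    set x₀ := unpadQ q z with hx₀
    set N₀ := x₀.length with hN₀
    set n := z.length with hn
    have hclock := hNc z
    rw [← hx₀] at hclock
    have h₁ := outputsWithin_truncMapAux_boolPair Nc (y := y) hclock
    simp only [List.length_replicate, ← hN₀] at h₁
    have hy' : (y.take (c * 2 ^ (N₀ ^ j) + c)).length ≤ c * 2 ^ (N₀ ^ j) + c :=
      List.length_take_le _ _
    have h₂ : V.machine.OutputsWithin (boolPair x₀ (y.take (c * 2 ^ (N₀ ^ j) + c)))
        (encodeBool (V.rel x₀ (y.take (c * 2 ^ (N₀ ^ j) + c)))) (c * 2 ^ (N₀ ^ j) + c) := by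
      have := V.outputsWithin x₀ (y.take (c * 2 ^ (N₀ ^ j) + c)) hy'
      rwa [← hN₀] at this
    have h := Turing.TM2ComputableAux.comp_outputsWithin _ _ h₁ h₂
    have hBz : B z = c * 2 ^ (N₀ ^ j) + c := by simp [B, hN₀, hx₀]
    rw [hBz]
    refine h.mono ?_
    -- the estimates
    set T := n ^ Nat.log 2 n ^ e with hT
    set P := 2 ^ (N₀ ^ j) with hP
    have hPT : P ≤ A * T + A := hA n N₀ (by rw [hN₀, hx₀, hn]; exact length_unpadQ_le_size_pow q z)
    have hN₀n : N₀ ≤ n := by rw [hN₀, hx₀, hn]; exact length_unpadQ_le q z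
    have hpoly := hA' n
    simp only [eval_add, eval_mul, eval_ofNat, eval_X] at hpoly
    have e1 : (C + 3 * c) * P ≤ (C + 3 * c) * (A * T + A) := Nat.mul_le_mul_left _ hPT
    have hy2 : 2 * (y.length / 2) ≤ (2 * K + 2) * T + (2 * K + 2) :=
      (Nat.mul_div_le y.length 2).trans hy
    simp only [K] at hy2 ⊢
    nlinarith [e1, hpoly, hy2, hN₀n]
  · -- correctness
    rw [mem_padLangQ, V.mem_iff (unpadQ q z)]
    set x₀ := unpadQ q z with hx₀
    have hBz : B z = c * 2 ^ (x₀.length ^ j) + c := rfl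
    constructor
    · rintro ⟨y₀, hy₀, hR⟩
      change y₀.length ≤ c * 2 ^ (x₀.length ^ j) + c at hy₀
      refine ⟨y₀, ?_, ?_⟩
      · have hPT : 2 ^ (x₀.length ^ j) ≤ A * z.length ^ Nat.log 2 z.length ^ e + A :=
          hA z.length x₀.length (by rw [hx₀]; exact length_unpadQ_le_size_pow q z)
        set T := z.length ^ Nat.log 2 z.length ^ e with hT
        have hcA : c * A ≤ K := by
          have h1 : c * A ≤ (C + 3 * c) * A := Nat.mul_le_mul_right A (by omega)
          show c * A ≤ A' + (C + 3 * c) * A + 3 * c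
          omega
        have hcK : c ≤ K := by
          show c ≤ A' + (C + 3 * c) * A + 3 * c
          omega
        calc y₀.length ≤ c * 2 ^ (x₀.length ^ j) + c := hy₀
          _ ≤ c * (A * T + A) + c := Nat.add_le_add_right (Nat.mul_le_mul_left c hPT) c
          _ = (c * A) * T + (c * A + c) := by ring
          _ ≤ K * T + (K + K) := Nat.add_le_add (Nat.mul_le_mul_right _ hcA) (Nat.add_le_add hcA hcK)
          _ ≤ (2 * K + 2) * T + (2 * K + 2) :=
              Nat.add_le_add (Nat.mul_le_mul_right _ (by omega)) (by omega)
      · show V.rel x₀ (y₀.take (B z)) = true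
        rwa [hBz, List.take_of_length_le hy₀]
    · rintro ⟨y, -, hR⟩
      exact ⟨y.take (B z), List.length_take_le _ _, hR⟩

/-- **The padded language of an `NTIME(2^{nʲ})` language lies in the level
`NTIME(n^{(log₂ n)^e})`** for `2jq ≤ e + 1`, `e ≥ 1` ("translating upward", Arora–Barak 2009,
§2.6.2, with a subexponential pad). [cite: AroraBarak2009, §2.6.2 (Thm. 2.22)] -/
theorem padLangQ_mem_NTIME_level {j q e : ℕ} (hj : 1 ≤ j) (he : 2 * j * q ≤ e + 1) (he1 : 1 ≤ e)
    {L : Language Bool} (hL : L ∈ NTIME (fun n => 2 ^ (n ^ j))) :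
    padLangQ q L ∈ NTIME (fun n => n ^ Nat.log 2 n ^ e) := by
  obtain ⟨V⟩ := mem_NTIME_iff_nonempty_nVerifier.1 hL
  obtain ⟨V', -⟩ := exists_padVerifierQ hj he he1 V
  exact mem_NTIME_iff_nonempty_nVerifier.2 ⟨V'⟩

/-- **Witness circuits come back along the padding.** If the padded language `padLangQ q L` has
witness circuits of size `w` for its verifiers of the level `n^{(log₂ n)^e}` (`2jq ≤ e + 1`,
`e ≥ 1`, `q ≠ 0`), then `L` has witness circuits of size `w (padLenQ q N)` for its
`2^{nʲ}`-verifiers: a `2^{nʲ}`-verifier `V` is padded (`exists_padVerifierQ`), the padded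
verifier has small witnesses on the canonical pads `padQ q x` of the long `x ∈ L`, and such a
witness, cut at `V`'s admissible length, is a witness of `V` for `x` that is still a prefix of
the same truth table (Murray–Williams 2018, §2: witness circuits are asked of every verifier;
Arora–Barak 2009, Thm. 2.6: a verifier ignores the part of the certificate it does not read).
[cite: MurrayWilliams2018, §2 (Witness Circuits)] -/
theorem HasWitnessCircuits.of_padLangQ {j q e : ℕ} (hj : 1 ≤ j) (hq : q ≠ 0)
    (he : 2 * j * q ≤ e + 1) (he1 : 1 ≤ e) {L : Language Bool} {w : ℕ → ℕ}
    (h : HasWitnessCircuits (fun n => n ^ Nat.log 2 n ^ e) (padLangQ q L) w) :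
    HasWitnessCircuits (fun n => 2 ^ (n ^ j)) L (fun N => w (padLenQ q N)) := by
  intro V
  obtain ⟨V', hV'⟩ := exists_padVerifierQ hj he he1 V
  obtain ⟨n₀, hn₀⟩ := h V'
  refine ⟨n₀, fun x hx hle => ?_⟩
  have hz : padQ q x ∈ padLangQ q L := (padQ_mem_padLangQ hq).2 hx
  have hzl : n₀ ≤ (padQ q x).length := hle.trans (by rw [length_padQ]; exact le_padLenQ q _)
  obtain ⟨m, W, y, hWB, hWs, -, hrel, hpre⟩ := hn₀ (padQ q x) hz hzl
  rw [hV', unpadQ_padQ hq] at hrel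
  refine ⟨m, W, y.take (V.c * 2 ^ (x.length ^ j) + V.c), hWB, ?_, List.length_take_le _ _,
    hrel, (List.take_prefix _ _).trans hpre⟩
  simpa only [length_padQ] using hWs

/-! ### The canonical pads are short enough: witness sizes come back subexponential -/

/-- Eventually the canonical pad is at most twice its power part: `padLenQ q N ≤ 2^{M(N)+1}`
(`⌊N^{1/q}⌋` outgrows `log₂ N`, `eventually_log_le_nthRoot`). [folklore] -/
theorem eventually_padLenQ_le {q : ℕ} (hq : q ≠ 0) :
    ∀ᶠ N in atTop, padLenQ q N ≤ 2 ^ (padExpQ q N + 1) := by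
  obtain ⟨N₁, hN₁⟩ := eventually_log_le_nthRoot 1 2 hq
  filter_upwards [eventually_ge_atTop N₁] with N hN
  have h := hN₁ N hN
  have h1 : N + 1 < 2 ^ (Nat.log 2 (N + 1) + 1) := Nat.lt_pow_succ_log_self one_lt_two _
  have h2 : 2 ^ (Nat.log 2 (N + 1) + 1) * 2 ≤ 2 ^ padExpQ q N := by
    rw [← pow_succ]
    exact Nat.pow_le_pow_right two_pos (by unfold padExpQ; omega)
  unfold padLenQ
  rw [pow_succ]
  omega

/-- Eventually `log₂ (padLenQ q N) ≤ M(N) + 1 = ⌊N^{1/q}⌋ + 2`. [folklore] -/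
theorem eventually_log_padLenQ_le {q : ℕ} (hq : q ≠ 0) :
    ∀ᶠ N in atTop, Nat.log 2 (padLenQ q N) ≤ padExpQ q N + 1 := by
  filter_upwards [eventually_padLenQ_le hq] with N hN
  calc Nat.log 2 (padLenQ q N) ≤ Nat.log 2 (2 ^ (padExpQ q N + 1)) := Nat.log_mono_right hN
    _ = padExpQ q N + 1 := Nat.log_pow one_lt_two _

/-- **The witness sizes come back subexponential**: with the padding parameter `q' = 2Kq`,
eventually `(log₂ (padLenQ q' N))^K ≤ ⌊N^{1/q}⌋`, so witness circuits of size
`2^{(log₂ n)^K}` for the padded language give witness circuits of size `2^{⌊N^{1/q}⌋}` for the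
original one (`a = ⌊N^{1/(2Kq)}⌋ ≥ 2` gives `(a + 2)^{Kq} ≤ a^{2Kq} ≤ N`). [folklore] -/
theorem eventually_log_padLenQ_pow_le {K q : ℕ} (hK : 1 ≤ K) (hq : 1 ≤ q) :
    ∀ᶠ N in atTop, Nat.log 2 (padLenQ (2 * K * q) N) ^ K ≤ Nat.nthRoot q N := by
  have hq' : 2 * K * q ≠ 0 := by positivity
  obtain ⟨N₁, hN₁⟩ := eventually_log_le_nthRoot 0 4 hq'
  filter_upwards [eventually_log_padLenQ_le hq', eventually_ge_atTop N₁] with N h1 hN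
  have h4 : 4 ≤ Nat.nthRoot (2 * K * q) N := by simpa using hN₁ N hN
  set a := Nat.nthRoot (2 * K * q) N with ha
  have h2 : Nat.log 2 (padLenQ (2 * K * q) N) ≤ a + 2 := by unfold padExpQ at h1; omega
  rw [Nat.le_nthRoot_iff (by omega : q ≠ 0)]
  calc (Nat.log 2 (padLenQ (2 * K * q) N) ^ K) ^ q ≤ ((a + 2) ^ K) ^ q :=
        Nat.pow_le_pow_left (Nat.pow_le_pow_left h2 K) q
    _ = (a + 2) ^ (K * q) := by rw [← pow_mul]
    _ ≤ (a * a) ^ (K * q) := Nat.pow_le_pow_left (by nlinarith) _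
    _ = a ^ (2 * K * q) := by rw [← pow_two, ← pow_mul, mul_assoc]
    _ ≤ N := Nat.pow_nthRoot_le_iff.2 (Or.inl hq')

/-! ### The hard language at the exponential level -/

/-- **A language in `NTIME(2ⁿ) ∖ NTIME(n + 2ⁿ/n)`**, from the tree's PROVED nondeterministic time
hierarchy theorem (`Diag.ntime_hierarchy_holds`, `DiagMachine.lean`; Arora–Barak 2009, Thm. 3.2)
at `g = 2ⁿ`, `f = williamsBound` (`TimeConstructible.isTimeConstructible_two_pow`,
`isTimeConstructible_williamsBound`, `isLittleO_williamsBound_succ`) — the pair used in the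
proof of Williams' Thm. 1.1. [cite: AroraBarak2009, Thm. 3.2] -/
theorem exists_mem_NTIME_two_pow_not_mem_williamsBound :
    ∃ L : Language Bool, L ∈ NTIME (fun n => 2 ^ n) ∧ L ∉ NTIME williamsBound := by
  exact Set.not_subset_iff_exists_mem_notMem.1 (Diag.ntime_hierarchy_holds williamsBound (fun n => 2 ^ n)
    isTimeConstructible_williamsBound TimeConstructible.isTimeConstructible_two_pow
    isLittleO_williamsBound_succ)

/-! ### Theorem 1.2 for `AC⁰[m]` over an exponential-level simulation -/

/-- **Assembly of Murray–Williams' Theorem 1.2 (for `AC⁰[m]`) over a simulation at the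
EXPONENTIAL level.** Hypotheses: `hEWL` — the easy witness lemma for `NQP` (Lemma 1.3) at the
tree's levels, verbatim as in `MurrayWilliams2018_thm_1_2_acc_of_EWL_of_simulation`
(`MurrayWilliams2018Hierarchy.lean`); `hN` — the nondeterministic simulation for languages of
`NTIME(2ⁿ)` (module docstring): under the depth-`(d + c₀)` `AC⁰[m]`-SAT algorithm with savings
`2^{⌊n^{1/r}⌋}` and depth-`d`, `2^{(log₂ n)^k}`-size `AC⁰[m]` circuits for `P`, every
`L ∈ NTIME(2ⁿ)` whose `2^{n³}`-verifiers have witness circuits of size `2^{⌊n^{1/q}⌋}` (the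
simulation names `q`) lies in `NTIME(n + 2ⁿ/n)`. Proof, by contradiction from (A) "every level
`NTIME[n^{log^e n}]` has depth-`d`, `2^{log^k n}`-size `AC⁰[m]` circuits": unrestricted circuits of
size `2^{log^{k+2} n}` a.e. (`eventually_circuitSize_le_of_mem_depthSizeClass`), witness circuits
of size `2^{log^K n}` at all levels `e ≥ e₀` (`hEWL`), the circuits of `P ⊆ NTIME[n^{log n}]`
(`P_subset_NTIME_pow_log`); the hard language `L₁ ∈ NTIME[2ⁿ] ∖ NTIME[n + 2ⁿ/n]` of the PROVED
hierarchy theorem (`exists_mem_NTIME_two_pow_not_mem_williamsBound`); its subexponentially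
padded version `padLangQ q' L₁`, `q' = 2Kq`, lies in the level `e = max e₀ 6q'`
(`padLangQ_mem_NTIME_level`), has witness circuits of size `2^{log^K n}` there, which come back
to the `2^{n³}`-verifiers of `L₁` with size `2^{⌊N^{1/q}⌋}` (`HasWitnessCircuits.of_padLangQ`,
`eventually_log_padLenQ_pow_le`); the simulation puts `L₁ ∈ NTIME[n + 2ⁿ/n]` — a contradiction.
(Murray–Williams run the same argument at the level `2^{log^{ck⁴/ε} n}` with the PCP of
Ben-Sasson–Viola; at the exponential level the efficient succinct Cook–Levin reduction of
Williams 2014, Fact 3.1, is available instead, see the module docstring.)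
[cite: MurrayWilliams2018, Thm. 1.2 (proof, §5) and Remark 1] -/
theorem MurrayWilliams2018_thm_1_2_acc_of_EWL_of_expSimulation
    (hEWL : ∀ k : ℕ, 1 ≤ k →
      (∀ e : ℕ, 1 ≤ e → ∀ L ∈ NTIME (fun n => n ^ Nat.log 2 n ^ e),
          ∀ᶠ n in atTop, L.circuitSize n ≤ 2 ^ Nat.log 2 n ^ k) →
        ∃ K e₀ : ℕ, 1 ≤ K ∧ ∀ e : ℕ, e₀ ≤ e →
          NTIMEHasWitnessCircuits (fun n => n ^ Nat.log 2 n ^ e) (fun n => 2 ^ Nat.log 2 n ^ K))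
    (hN : ∃ c₀ : ℕ, ∀ (d m k r : ℕ), 2 ≤ m → 1 ≤ k → 2 ≤ r →
      AccSatSubexp (d + c₀) m r →
      (Classes.P ⊆ ⋃ a : ℕ,
          DepthSizeClass (accBasis m) (fun _ => d) (fun n => a * 2 ^ Nat.log 2 n ^ k + a)) →
      ∃ q : ℕ, 1 ≤ q ∧ ∀ L ∈ NTIME (fun n => 2 ^ n),
        HasWitnessCircuits (fun n => 2 ^ (n ^ 3)) L (fun n => 2 ^ Nat.nthRoot q n) →
        L ∈ NTIME williamsBound) :
    MurrayWilliams2018_thm_1_2_acc := by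
  intro d m hm hsat k
  by_contra hcon
  -- (A): every language of every level `e ≥ 1` has small depth-`d` `AC⁰[m]` circuits
  have hA : ∀ e : ℕ, 1 ≤ e → ∀ L ∈ NTIME (fun n => n ^ Nat.log 2 n ^ e), ∃ c : ℕ,
      L ∈ DepthSizeClass (accBasis m) (fun _ => d) (fun n => c * 2 ^ Nat.log 2 n ^ k + c) := by
    intro e he L hL
    by_contra h
    exact hcon ⟨e, he, L, hL, fun c hc => h ⟨c, hc⟩⟩
  obtain ⟨c₀, hN⟩ := hN
  obtain ⟨r, hr, hS⟩ := hsat (d + c₀)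
  -- (i) unrestricted circuits of size `2^{(log n)^{k+2}}` almost everywhere
  have hSIZE : ∀ e : ℕ, 1 ≤ e → ∀ L ∈ NTIME (fun n => n ^ Nat.log 2 n ^ e),
      ∀ᶠ n in atTop, L.circuitSize n ≤ 2 ^ Nat.log 2 n ^ (k + 2) := by
    intro e he L hL
    obtain ⟨c, hc⟩ := hA e he L hL
    exact eventually_circuitSize_le_of_mem_depthSizeClass hm hc
  -- (ii) witness circuits (Lemma 1.3 at exponent `k + 2`)
  obtain ⟨K, e₀, hK1, he₀⟩ := hEWL (k + 2) (by omega) hSIZE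
  -- (iii) `P` has the assumed circuits (exponent `k + 1 ≥ 1`)
  have hP : Classes.P ⊆ ⋃ a : ℕ,
      DepthSizeClass (accBasis m) (fun _ => d) (fun n => a * 2 ^ Nat.log 2 n ^ (k + 1) + a) := by
    intro L hL
    obtain ⟨c, hc⟩ := hA 1 le_rfl L (P_subset_NTIME_pow_log hL)
    exact Set.mem_iUnion.2 ⟨2 * c, DepthSizeClass_mono le_rfl (fun _ => le_rfl)
      (fun n => mul_two_pow_log_pow_le_succ c k n) hc⟩
  -- (iv) the simulation names its witness-size exponent `q`
  obtain ⟨q, hq, hNq⟩ := hN d m (k + 1) r hm (by omega) hr hS hP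
  -- (v) the hard language of the PROVED hierarchy theorem, at the exponential level
  obtain ⟨L₁, hL₁, hL₁w⟩ := exists_mem_NTIME_two_pow_not_mem_williamsBound
  -- (vi) padding parameter `q' = 2Kq` and level `e = max e₀ (6 q')`
  have hq'0 : 2 * K * q ≠ 0 := by positivity
  have hq'1 : 1 ≤ 2 * K * q := Nat.pos_of_ne_zero hq'0
  obtain ⟨e, he⟩ : ∃ e : ℕ, e = max e₀ (6 * (2 * K * q)) := ⟨_, rfl⟩
  have he6 : 2 * 3 * (2 * K * q) ≤ e + 1 := by omega
  have he2 : 2 * 1 * (2 * K * q) ≤ e + 1 := by omega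
  have he1 : 1 ≤ e := by omega
  have hL₁' : L₁ ∈ NTIME (fun n => 2 ^ (n ^ 1)) := by simpa only [pow_one] using hL₁
  have hpad : padLangQ (2 * K * q) L₁ ∈ NTIME (fun n => n ^ Nat.log 2 n ^ e) :=
    padLangQ_mem_NTIME_level le_rfl he2 he1 hL₁'
  -- (vii) witness circuits at the level `e`, brought back to the `2^{n³}`-verifiers of `L₁`
  have hw : HasWitnessCircuits (fun n => n ^ Nat.log 2 n ^ e) (padLangQ (2 * K * q) L₁)
      (fun n => 2 ^ Nat.log 2 n ^ K) := he₀ e (he ▸ le_max_left _ _) _ hpad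
  have hw3 := hw.of_padLangQ (j := 3) (by norm_num) hq'0 he6 he1
  have hw3' : HasWitnessCircuits (fun n => 2 ^ (n ^ 3)) L₁ (fun n => 2 ^ Nat.nthRoot q n) :=
    hw3.mono ((eventually_log_padLenQ_pow_le hK1 hq).mono fun N hN =>
      Nat.pow_le_pow_right two_pos hN)
  -- (viii) the simulation puts `L₁` in `NTIME williamsBound`: contradiction
  exact hL₁w (hNq L₁ hL₁ hw3')

/-! ### Consequences over the remaining components -/

/-- **Murray–Williams' Theorem 1.2 for `AC⁰[m]` from Lemma 4.1 (a.e. form) and the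
exponential-level simulation** — the hierarchy being the theorem `Diag.ntime_hierarchy_holds`
and Lemma 1.3 being `MurrayWilliams2018_lemma_1_3_of_lemma_4_1_ae`
(`MurrayWilliams2018Lemma13.lean`). [cite: MurrayWilliams2018, Thm. 1.2 (proof, §5)] -/
theorem MurrayWilliams2018_thm_1_2_acc_of_lemma_4_1_ae_of_expSimulation
    (h41 : MurrayWilliams2018_lemma_4_1_ae)
    (hN : ∃ c₀ : ℕ, ∀ (d m k r : ℕ), 2 ≤ m → 1 ≤ k → 2 ≤ r →
      AccSatSubexp (d + c₀) m r →
      (Classes.P ⊆ ⋃ a : ℕ,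
          DepthSizeClass (accBasis m) (fun _ => d) (fun n => a * 2 ^ Nat.log 2 n ^ k + a)) →
      ∃ q : ℕ, 1 ≤ q ∧ ∀ L ∈ NTIME (fun n => 2 ^ n),
        HasWitnessCircuits (fun n => 2 ^ (n ^ 3)) L (fun n => 2 ^ Nat.nthRoot q n) →
        L ∈ NTIME williamsBound) :
    MurrayWilliams2018_thm_1_2_acc :=
  MurrayWilliams2018_thm_1_2_acc_of_EWL_of_expSimulation
    (MurrayWilliams2018_lemma_1_3_of_lemma_4_1_ae h41) hN

/-- **`MurrayWilliams2018_NQP_not_ACC` over the remaining components**: Lemma 4.1 (a.e. form),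
the exponential-level simulation and Williams' `ACC`-SAT algorithm (J. ACM 2014, Thm. 4.1,
giving Thm. 5.1 by `MurrayWilliams2018_thm_5_1_of_thm_4_1`); the hierarchy is the theorem
`Diag.ntime_hierarchy_holds`. [cite: MurrayWilliams2018, §1.1, Thm. 1.2, Thm. 5.1] -/
theorem MurrayWilliams2018_NQP_not_ACC_of_lemma_4_1_ae_of_expSimulation
    (h41 : MurrayWilliams2018_lemma_4_1_ae)
    (hN : ∃ c₀ : ℕ, ∀ (d m k r : ℕ), 2 ≤ m → 1 ≤ k → 2 ≤ r →
      AccSatSubexp (d + c₀) m r →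
      (Classes.P ⊆ ⋃ a : ℕ,
          DepthSizeClass (accBasis m) (fun _ => d) (fun n => a * 2 ^ Nat.log 2 n ^ k + a)) →
      ∃ q : ℕ, 1 ≤ q ∧ ∀ L ∈ NTIME (fun n => 2 ^ n),
        HasWitnessCircuits (fun n => 2 ^ (n ^ 3)) L (fun n => 2 ^ Nat.nthRoot q n) →
        L ∈ NTIME williamsBound)
    (hW : Williams2014_thm_4_1) : MurrayWilliams2018_NQP_not_ACC :=
  MurrayWilliams2018_NQP_not_ACC_of_thm_1_2_acc
    (MurrayWilliams2018_thm_1_2_acc_of_lemma_4_1_ae_of_expSimulation h41 hN)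
    (MurrayWilliams2018_thm_5_1_of_thm_4_1 hW)

/-- **The headline `¬ (NQP ⊆ ACC⁰)` (`MurrayWilliams2018_NQP_not_subset_ACC0`) over the same
remaining components.** [cite: MurrayWilliams2018, §1.1 and Thm. 1.3] -/
theorem MurrayWilliams2018_NQP_not_subset_ACC0_of_lemma_4_1_ae_of_expSimulation
    (h41 : MurrayWilliams2018_lemma_4_1_ae)
    (hN : ∃ c₀ : ℕ, ∀ (d m k r : ℕ), 2 ≤ m → 1 ≤ k → 2 ≤ r →
      AccSatSubexp (d + c₀) m r →
      (Classes.P ⊆ ⋃ a : ℕ,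
          DepthSizeClass (accBasis m) (fun _ => d) (fun n => a * 2 ^ Nat.log 2 n ^ k + a)) →
      ∃ q : ℕ, 1 ≤ q ∧ ∀ L ∈ NTIME (fun n => 2 ^ n),
        HasWitnessCircuits (fun n => 2 ^ (n ^ 3)) L (fun n => 2 ^ Nat.nthRoot q n) →
        L ∈ NTIME williamsBound)
    (hW : Williams2014_thm_4_1) : MurrayWilliams2018_NQP_not_subset_ACC0 :=
  (MurrayWilliams2018_NQP_not_ACC_of_lemma_4_1_ae_of_expSimulation h41 hN hW).not_subset_ACC0

/-- **Theorem 1.3 (threshold-free form, `MurrayWilliams2018_NTIME_not_depth_ACC`) over the same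
remaining components** — Lemma 4.1 (a.e. form), the exponential-level simulation, Williams'
Theorem 4.1 (`MurrayWilliams2018_NTIME_not_depth_ACC_of_thm_1_2_of_thm_4_1`,
`Williams2014AccSat.lean`); the hierarchy is the theorem `Diag.ntime_hierarchy_holds`.
[cite: MurrayWilliams2018, Thm. 1.3] -/
theorem MurrayWilliams2018_NTIME_not_depth_ACC_of_lemma_4_1_ae_of_expSimulation
    (h41 : MurrayWilliams2018_lemma_4_1_ae)
    (hN : ∃ c₀ : ℕ, ∀ (d m k r : ℕ), 2 ≤ m → 1 ≤ k → 2 ≤ r →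
      AccSatSubexp (d + c₀) m r →
      (Classes.P ⊆ ⋃ a : ℕ,
          DepthSizeClass (accBasis m) (fun _ => d) (fun n => a * 2 ^ Nat.log 2 n ^ k + a)) →
      ∃ q : ℕ, 1 ≤ q ∧ ∀ L ∈ NTIME (fun n => 2 ^ n),
        HasWitnessCircuits (fun n => 2 ^ (n ^ 3)) L (fun n => 2 ^ Nat.nthRoot q n) →
        L ∈ NTIME williamsBound)
    (hW : Williams2014_thm_4_1) : MurrayWilliams2018_NTIME_not_depth_ACC :=
  MurrayWilliams2018_NTIME_not_depth_ACC_of_thm_1_2_of_thm_4_1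
    (MurrayWilliams2018_thm_1_2_acc_of_lemma_4_1_ae_of_expSimulation h41 hN) hW

end Literature.Computability.Complexity
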